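import Literature.Barriers.CriticalPhenomena.WeaklySAWSuperGaussian
import Literature.MathematicalPhysics.QuantumLattice.GrassmannGaussianMeasureChange
import Literature.Barriers.CriticalPhenomena.WeaklySAWSkeletonGaussFourier
import HarnessLib

/-!
# The `τ`-isomorphism for the weakly self-avoiding walk weight, form side:
# `∫ e^{-S_A} e^{-Σ(gτ_x²+ντ_x)} φ̄_a φ_b = ∫ ρ_g^{⊗Λ}(w) ((A + ν + iW)⁻¹)_{a,b} dw`

Fourth file of the series formalising Proposition 3.1 of Bauerschmidt–Brydges–Slade, CMP 337 (2015),
arXiv:1403.7422 (`G_{N,g,ν}(a,b) = ∫ e^{-Σ_x(τ_{Δ,x}+gτ_x²+ντ_x)} φ̄_aφ_b`), following [BIS09]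
(Brydges–Imbrie–Slade, Probab. Surveys 6 (2009), arXiv:0906.0922) Proposition 4.4 / Theorem 5.1: the
`τ`-isomorphism `∫e^{-S_A}F(τ)φ̄_aφ_b = ∫₀^∞ E_a(F(L_T)𝟙_{X(T)=b})dT` for `F(t) = e^{-gΣt_x²-νΣt_x}`,
proved in the source by Fourier-decomposing `F` and using, for each frequency, the Gaussian identity
`∫e^{-S_{A-εI+iV}}φ̄_aφ_b = (A-εI+iV)⁻¹_{ab}` and the resolvent formula for the walk. For this `F` the
Fourier decomposition is explicit, Gaussian and site by site (`ρ_g` of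
`WeaklySAWSkeletonGaussFourier.lean`), which is the route taken here. This file is the FORM SIDE.

* The interaction form (§"Algebra"): `pairBar x = ψ̄_xψ_x` (central, square zero),
  `quadratic_diagonal`, `grassmannExp_quadratic_diagonal`
  (`exp(Σβ_xψ̄_xψ_x) = Σ_{S⊆Λ}(Π_{S}β_x)Π_{S}ψ̄_xψ_x`, the tree's `exp_sum_eq_sum_noncommProd`),
  `interactionScalar` (`a_x = g|φ_x|⁴+ν|φ_x|²`), `interactionCoeff` (`b_x = 2g|φ_x|²+ν`),
  **`interactionForm g ν = e^{-Σ_x(gτ_x²+ντ_x)} := e^{-Σa_x}·exp(Σ_x b_xψ̄_xψ_x)`** with `interaction_eq`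
  (`gτ_x²+ντ_x = a_x - b_xψ̄_xψ_x` in the algebra of forms, `τ_x = |φ_x|² - ψ̄_xψ_x`, `(ψ̄_xψ_x)² = 0`: so
  the definition IS the source's "function of even forms by Taylor expansion about the degree-0 part",
  BBS 2015 (3.4)–(3.5)), `superGauss_mul_interactionForm` (`e^{-S_A}e^{-Σ(gτ²+ντ)} =
  e^{-φAφ̄-Σa_x}exp(ψ̄(Aᵀ+diag b)ψ)`);
* top coefficients (§"TopCoefficients"): `pairMoment`, the master formula
  `berezin_ofFun_mul_grassmannExp_quadratic_add_diagonal` (`∫dψ̄dψ f e^{ψ̄(Q+diag β)ψ} = fΣ_S(Π_Sβ)m_S(Q)`),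
  `pairMoment_constMat` (`m_S = ε·det(rowUnitMatrix Q S)`, the tree's row-replacement Wick rule),
  `superGauss_add_diagonal` (`e^{-S_{A+diag v}}`), and the two explicit top coefficients
  `berezin_ofFun_mul_superGauss_mul_interactionForm_apply`, `berezin_ofFun_mul_superGauss_add_diagonal_apply`;
* per-site Gaussian–Fourier identities (§"PerSite"): `integral_gaussDensity_mul_cexp_neg`
  (`∫ρ_g(w)e^{-(ν+iw)s}dw = e^{-νs-gs²}`) and `integral_gaussDensity_mul_lin_mul_cexp_neg`
  (`∫ρ_g(w)(ν+iw)e^{-(ν+iw)s}dw = (ν+2gs)e^{-νs-gs²}`, by differentiating the former under the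
  integral sign in `s`);
* §"FormSide": `integral_prod_gaussDensity_site` (site-by-site factorisation),
  `re_quadForm_add_diagonal_ge` (`A + ν + iW` has positive Hermitian part `ν` when `Re φAφ̄ ≥ 0`),
  **`berezin_interaction_eq_integral`** (the top coefficient of `h e^{-S_A}e^{-Σ(gτ²+ντ)}` is the
  `ρ_g^{⊗Λ}`-average of those of `h e^{-S_{A+ν+iW}}` — "replace `t` by `τ`" in the Fourier formula), and
  the main result **`superIntegral_interaction_eq_integral_resolvent`**:
  `∫ e^{-S_A}e^{-Σ_x(gτ_x²+ντ_x)} φ̄_aφ_b = ∫_{ℝ^Λ} Π_xρ_g(w_x)·((A+ν+iW)⁻¹)_{a,b} dw`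
  for every complex `A` with `Re φAφ̄ ≥ 0`, `g > 0`, `ν > 0` (Fubini with an explicit Gaussian×polynomial
  dominating function, then `∫e^{-S_B}φ̄_aφ_b = (B⁻¹)_{ab}` of `WeaklySAWSuperGaussian.lean`).

Everything is proved; no named facts. The walk side and the identification with `G_{N,ν}` on the torus
(`A = -Δ_Λ`) are assembled in the sequel.
-/

noncomputable section

open MeasureTheory Filter Topology Set Complex ComplexConjugate
open Literature.MathematicalPhysics.QuantumLattice
open Literature.MathematicalPhysics.QuantumLattice.GrassmannAlgebra (berezin gen exp_sum_eq_sum_noncommProd)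
open scoped BigOperators

namespace Literature.Barriers.CriticalPhenomena

namespace CTWSAW

section Algebra

variable {Λ : Type*}

/-- `ofFun` is additive. [folklore] -/
theorem ofFun_add (f g : FieldFun Λ) : ofFun (f + g) = ofFun f + ofFun g := map_add _ f g

/-- `ofFun` is multiplicative. [folklore] -/
theorem ofFun_mul' (f g : FieldFun Λ) : ofFun (f * g) = ofFun f * ofFun g := map_mul _ f g

variable [LinearOrder Λ]

/-! ### The pair `ψ̄_xψ_x`, diagonal quadratic actions and their exponentials -/

/-- `ψ̄_x ψ_x` (`= -ψ_xψ̄_x`; central, square zero). [folklore] -/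
def pairBar (x : Λ) : SForm Λ := psiBar (FieldFun Λ) x * psi (FieldFun Λ) x

/-- `ψ̄_xψ_x` is central. [folklore] -/
theorem commute_pairBar (x : Λ) (z : SForm Λ) : Commute (pairBar x) z := commute_psiBar_mul_psi _ x x z

/-- `(ψ̄_xψ_x)² = 0`. [folklore] -/
theorem pairBar_mul_self (x : Λ) : pairBar x * pairBar x = (0 : SForm Λ) :=
  psiBar_mul_psi_mul_psiBar_mul_psi_self _ x x x

variable [Fintype Λ]

/-- The quadratic action of a diagonal matrix: `quadratic (diag β) = Σ_x β_x ψ̄_xψ_x`. [folklore] -/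
theorem quadratic_diagonal (β : Λ → FieldFun Λ) :
    quadratic (FieldFun Λ) (Matrix.diagonal β) = ∑ x, β x • pairBar x := by
  unfold quadratic pairBar
  refine Finset.sum_congr rfl fun x _ => ?_
  rw [Finset.sum_eq_single x]
  · rw [Matrix.diagonal_apply_eq]
  · intro y _ hy; rw [Matrix.diagonal_apply_ne _ (Ne.symm hy), zero_smul]
  · intro h; exact absurd (Finset.mem_univ x) h

omit [Fintype Λ] in
/-- Scalar multiples pass through non-commutative products of commuting factors:
`Π (c_x • y_x) = (Π c_x) • Π y_x`. [folklore] -/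
theorem noncommProd_smul (S : Finset Λ) (c : Λ → FieldFun Λ) (y : Λ → SForm Λ)
    (hy : ∀ i z, Commute (y i) z) :
    S.noncommProd (fun x => c x • y x) (fun i _ j _ _ => ((hy i (y j)).smul_left (c i)).smul_right (c j)) =
      (∏ x ∈ S, c x) • S.noncommProd y fun i _ j _ _ => hy i (y j) := by
  classical
  induction S using Finset.induction_on with
  | empty => simp
  | insert a S ha ih =>
    rw [Finset.noncommProd_insert_of_notMem _ _ _ _ ha, Finset.noncommProd_insert_of_notMem _ _ _ _ ha,
      Finset.prod_insert ha, ih, smul_mul_smul_comm, mul_smul]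

/-- **`exp(Σ_x β_x ψ̄_xψ_x) = Σ_{S⊆Λ} (Π_{x∈S} β_x) Π_{x∈S} ψ̄_xψ_x`** (the exponential of a diagonal
quadratic action; each `β_xψ̄_xψ_x` is central with square zero). [folklore] -/
theorem grassmannExp_quadratic_diagonal (β : Λ → FieldFun Λ) :
    grassmannExp (quadratic (FieldFun Λ) (Matrix.diagonal β)) =
      ∑ S : Finset Λ, (∏ x ∈ S, β x) • S.noncommProd pairBar fun i _ _ _ _ => commute_pairBar i _ := by
  classical
  rw [quadratic_diagonal, grassmannExp]
  have h := exp_sum_eq_sum_noncommProd (A := SForm Λ) (fun x => β x • pairBar x)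
    (fun i z => (commute_pairBar i z).smul_left (β i))
    (fun i => by rw [smul_mul_smul_comm, pairBar_mul_self, smul_zero]) Finset.univ
  rw [h, Finset.powerset_univ]
  refine Finset.sum_congr rfl fun S _ => ?_
  rw [← noncommProd_smul S β pairBar fun i z => commute_pairBar i z]

/-! ### The interaction form `e^{-Σ_x(gτ_x² + ντ_x)}` -/

/-- The degree-zero part `a_x(φ) = g|φ_x|⁴ + ν|φ_x|²` of `gτ_x² + ντ_x`. [folklore] -/
def interactionScalar (g ν : ℝ) (x : Λ) : FieldFun Λ := fun φ => ((g * ‖φ x‖ ^ 4 + ν * ‖φ x‖ ^ 2 : ℝ) : ℂ)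

/-- The coefficient `b_x(φ) = 2g|φ_x|² + ν` of `ψ̄_xψ_x` in `-(gτ_x² + ντ_x)`. [folklore] -/
def interactionCoeff (g ν : ℝ) (x : Λ) : FieldFun Λ := fun φ => ((2 * g * ‖φ x‖ ^ 2 + ν : ℝ) : ℂ)

/-- **The weakly self-avoiding interaction `e^{-Σ_x(gτ_x² + ντ_x)}`** as a form. Since
`τ_x = φ_xφ̄_x + ψ_xψ̄_x = |φ_x|² - ψ̄_xψ_x` and `(ψ̄_xψ_x)² = 0`, `gτ_x² + ντ_x = a_x - b_xψ̄_xψ_x` with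
`a_x = g|φ_x|⁴ + ν|φ_x|²`, `b_x = 2g|φ_x|² + ν` (`interaction_eq`), so by the definition of functions
of even forms through their Taylor series about the degree-zero part (source, (3.4)–(3.5)),
`e^{-Σ_x(gτ_x²+ντ_x)} = e^{-Σa_x} · exp(Σ_x b_xψ̄_xψ_x)` — which is the definition taken here.
[cite: BauerschmidtBrydgesSlade2015LogCorr, §3.2, eqs. (3.4)–(3.5) (functions of even forms) and Proposition 3.1 (the integrand e^{-Σ(τ_Δ,x + gτ_x² + ντ_x)})]
[cite: BrydgesImbrieSlade2009, Theorem 5.1 (e^{-gΣτ_x² - λΣτ_x})] -/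
def interactionForm (g ν : ℝ) : SForm Λ :=
  ofFun (fun φ => cexp (-∑ x, interactionScalar g ν x φ)) *
    grassmannExp (quadratic (FieldFun Λ) (Matrix.diagonal (interactionCoeff g ν)))

omit [Fintype Λ] in
/-- `gτ_x² + ντ_x = a_x - b_x ψ̄_xψ_x` in the algebra of forms (with `τ_x = |φ_x|² - ψ̄_xψ_x`,
`(ψ̄_xψ_x)² = 0`; the couplings `g, ν` enter as constant `0`-forms).
[cite: BauerschmidtBrydgesSlade2015LogCorr, §3.3, eq. (3.8) (τ_x) with §3.2 (3.5) (example e^{-φφ̄-ψψ̄} = e^{-φφ̄}(1-ψψ̄))] -/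
theorem interaction_eq (g ν : ℝ) (x : Λ) :
    (ofFun (constFun (g : ℂ)) * (tau x * tau x) + ofFun (constFun (ν : ℂ)) * tau x : SForm Λ) =
      ofFun (interactionScalar g ν x) - ofFun (interactionCoeff g ν x) * pairBar x := by
  set s : FieldFun Λ := fun φ => (((‖φ x‖ ^ 2 : ℝ)) : ℂ) with hs
  have htau : (tau x : SForm Λ) = ofFun s - pairBar x := by
    rw [tau, pairBar, psi_mul_psiBar, sub_eq_add_neg]
    congr 2
    funext φ; rw [Complex.mul_conj, Complex.normSq_eq_norm_sq]
  have hc : Commute (ofFun s : SForm Λ) (pairBar x) := Algebra.commutes s _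
  have h1 : (ofFun s - pairBar x) * (ofFun s - pairBar x) =
      ofFun (s * s) - (ofFun s * pairBar x + ofFun s * pairBar x) := by
    rw [sub_mul, mul_sub, mul_sub, hc.eq, pairBar_mul_self, sub_zero, ofFun_mul_ofFun]
    abel
  have ha : interactionScalar g ν x = constFun (g : ℂ) * (s * s) + constFun (ν : ℂ) * s := by
    funext φ; simp only [interactionScalar, constFun, Pi.add_apply, Pi.mul_apply, hs]; push_cast; ring
  have hb : interactionCoeff g ν x = constFun (g : ℂ) * s + constFun (g : ℂ) * s + constFun (ν : ℂ) := by
    funext φ; simp only [interactionCoeff, constFun, Pi.add_apply, Pi.mul_apply, hs]; push_cast; ring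
  rw [htau, h1, ha, hb]
  simp only [ofFun_add, ofFun_mul']
  noncomm_ring

/-- **`e^{-S_A} · e^{-Σ(gτ²+ντ)}`** factorised: `e^{-φAφ̄ - Σa_x} · exp(quadratic(Aᵀ + diag b))` — the
bosonic weights multiply and the two commuting even exponentials merge
(`exp(ψ̄Qψ)exp(ψ̄Nψ) = exp(ψ̄(Q+N)ψ)`). [folklore] -/
theorem superGauss_mul_interactionForm (A : Matrix Λ Λ ℂ) (g ν : ℝ) :
    superGauss A * interactionForm g ν =
      ofFun (fun φ => Boson.gaussWeight A φ * cexp (-∑ x, interactionScalar g ν x φ)) *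
        grassmannExp (quadratic (FieldFun Λ)
          (constMat A.transpose + Matrix.diagonal (interactionCoeff g ν))) := by
  have hfun : (fun φ => Boson.gaussWeight A φ * cexp (-∑ x, interactionScalar g ν x φ)) =
      (fun φ => Boson.gaussWeight A φ) * fun φ => cexp (-∑ x, interactionScalar g ν x φ) := rfl
  rw [superGauss_eq, interactionForm, grassmannExp_quadratic_add, hfun, ← ofFun_mul_ofFun]
  -- `(f E)(h F) = (f h)(E F)` since `h` is central
  set E₁ := grassmannExp (quadratic (FieldFun Λ) (constMat A.transpose))
  rw [mul_assoc, ← mul_assoc E₁, (ofFun_comm _ E₁).symm, mul_assoc, ← mul_assoc]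

end Algebra



/-! ### Top coefficients: the master formula for `e^{ψ̄(Q + diag β)ψ}` -/

section TopCoefficients

variable {Λ : Type*} [Fintype Λ] [LinearOrder Λ]

/-- The fermionic `S`-moment `m_S(Q) = ∫dψ̄dψ e^{ψ̄Qψ} Π_{x∈S} ψ̄_xψ_x` of a Gaussian Berezin integral
(a principal-minor determinant by the fermionic Wick rule). [cite: BrydgesImbrieSlade2009, Proposition 4.1, eq. (Efac) (∫e^{-S_A}F = det C_{i;j} for F a product of pairs)] -/
def pairMoment (Q : Matrix Λ Λ (FieldFun Λ)) (S : Finset Λ) : FieldFun Λ :=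
  berezin (FieldFun Λ) (Λ ⊕ₗ Λ)
    (grassmannExp (quadratic (FieldFun Λ) Q) * S.noncommProd pairBar fun i _ _ _ _ => commute_pairBar i _)

/-- **Master formula**: for any `0`-form `f`, matrix of `0`-forms `Q` and diagonal `β`,
`∫dψ̄dψ f·e^{ψ̄(Q+diag β)ψ} = f · Σ_{S⊆Λ} (Π_{x∈S}β_x) m_S(Q)`. [folklore] -/
theorem berezin_ofFun_mul_grassmannExp_quadratic_add_diagonal (f : FieldFun Λ)
    (Q : Matrix Λ Λ (FieldFun Λ)) (β : Λ → FieldFun Λ) :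
    berezin (FieldFun Λ) (Λ ⊕ₗ Λ) (ofFun f * grassmannExp (quadratic (FieldFun Λ) (Q + Matrix.diagonal β))) =
      f * ∑ S : Finset Λ, (∏ x ∈ S, β x) * pairMoment Q S := by
  rw [grassmannExp_quadratic_add, grassmannExp_quadratic_diagonal, Finset.mul_sum, Finset.mul_sum,
    map_sum, Finset.mul_sum]
  refine Finset.sum_congr rfl fun S _ => ?_
  rw [mul_smul_comm, ofFun_mul, map_smul, map_smul, smul_eq_mul, smul_eq_mul, pairMoment]

/-- The complex matrix whose rows in `S` are replaced by unit rows (its determinant is the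
principal minor of `Q` on `Λ ∖ S`). [folklore] -/
def rowUnitMatrix (Q : Matrix Λ Λ ℂ) (S : Finset Λ) : Matrix Λ Λ ℂ :=
  Matrix.of fun r c => if r ∈ S then (Pi.single r (1 : ℂ) : Λ → ℂ) c else Q r c

/-- **`m_S` for constant coefficients is the constant `ε·det(rowUnitMatrix Q S)`** (the tree's
row-replacement Wick rule `berezin_grassmannExp_quadratic_mul_noncommProd`). [cite: BrydgesImbrieSlade2009, Proposition 4.1, eq. (Efac)] -/
theorem pairMoment_constMat (Q : Matrix Λ Λ ℂ) (S : Finset Λ) :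
    pairMoment (constMat Q) S = constFun (orientSign Λ * (rowUnitMatrix Q S).det) := by
  have h := berezin_grassmannExp_quadratic_mul_noncommProd (FieldFun Λ) (constMat Q) S id
  rw [pairMoment]
  have hprod : S.noncommProd pairBar (fun i _ _ _ _ => commute_pairBar i _) =
      S.noncommProd (fun r => psiBar (FieldFun Λ) r * psi (FieldFun Λ) (id r))
        (fun r _ _ _ _ => commute_psiBar_mul_psi (FieldFun Λ) r (id r) _) := rfl
  rw [hprod, h, neg_one_pow_eq_constFun]
  have hmat : (Matrix.of fun r c => if r ∈ S then (Pi.single (id r) (1 : FieldFun Λ) : Λ → FieldFun Λ) c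
      else constMat Q r c) = (constHom (Λ := Λ)).mapMatrix (rowUnitMatrix Q S) := by
    ext r c φ
    simp only [Matrix.of_apply, RingHom.mapMatrix_apply, Matrix.map_apply, rowUnitMatrix, id]
    by_cases hr : r ∈ S
    · simp only [hr, if_true, Pi.single_apply]
      split_ifs <;> simp [constHom]
    · simp [hr, constMat, constHom]
  rw [hmat, ← RingHom.map_det]
  funext φ; simp [constFun, constHom]

/-- `constMat` is additive. [folklore] -/
theorem constMat_add (A B : Matrix Λ Λ ℂ) : constMat (A + B) = constMat A + constMat B := map_add _ A B

/-- `constMat` of a diagonal matrix. [folklore] -/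
theorem constMat_diagonal (v : Λ → ℂ) :
    constMat (Matrix.diagonal v) = Matrix.diagonal fun x => (constFun (v x) : FieldFun Λ) := by
  ext x y φ
  simp only [constMat_apply, Matrix.diagonal_apply]
  split_ifs <;> simp [constFun]

/-- `φ(diag v)φ̄ = Σ_x v_x |φ_x|²`. [folklore] -/
theorem quadForm_diagonal (v : Λ → ℂ) (φ : Λ → ℂ) :
    Boson.quadForm (Matrix.diagonal v) φ = ∑ x, v x * (((‖φ x‖ ^ 2 : ℝ)) : ℂ) := by
  unfold Boson.quadForm
  refine Finset.sum_congr rfl fun x _ => ?_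
  rw [Finset.sum_eq_single x]
  · rw [Matrix.diagonal_apply_eq, mul_comm (φ x), mul_assoc, Complex.mul_conj, Complex.normSq_eq_norm_sq]
  · intro y _ hy
    rw [Matrix.diagonal_apply_ne _ (Ne.symm hy)]; ring
  · intro h; exact absurd (Finset.mem_univ x) h

omit [LinearOrder Λ] in
/-- `φ(A + D)φ̄ = φAφ̄ + φDφ̄`. [folklore] -/
theorem quadForm_add (A B : Matrix Λ Λ ℂ) (φ : Λ → ℂ) :
    Boson.quadForm (A + B) φ = Boson.quadForm A φ + Boson.quadForm B φ := by
  have h := quadForm_add_smul A B 1 φ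
  rwa [one_smul, one_mul] at h

/-- **`e^{-S_{A + diag v}} = e^{-φAφ̄ - Σv_x|φ_x|²} · exp(ψ̄(Aᵀ + diag v)ψ)`** for a complex diagonal
perturbation (the forms `e^{-S_{A - εI + iV}}` of [BIS09, Proposition 4.4]). [cite: BrydgesImbrieSlade2009, Proposition 4.4 (proof: ∫e^{-S_A}e^{Σ(-iv_x+ε)τ_x} = ∫e^{-S_{A-εI+iV}})] -/
theorem superGauss_add_diagonal (A : Matrix Λ Λ ℂ) (v : Λ → ℂ) :
    superGauss (A + Matrix.diagonal v) =
      ofFun (fun φ => Boson.gaussWeight A φ * cexp (-∑ x, v x * (((‖φ x‖ ^ 2 : ℝ)) : ℂ))) *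
        grassmannExp (quadratic (FieldFun Λ)
          (constMat A.transpose + Matrix.diagonal fun x => (constFun (v x) : FieldFun Λ))) := by
  rw [superGauss_eq, Matrix.transpose_add, Matrix.diagonal_transpose, constMat_add, constMat_diagonal]
  congr 1
  congr 1
  funext φ
  rw [Boson.gaussWeight, Boson.gaussWeight, quadForm_add, neg_add, Complex.exp_add, quadForm_diagonal]

/-- **Top coefficient of `h · e^{-S_A} · e^{-Σ(gτ²+ντ)}`**:
`h(φ) e^{-φAφ̄} e^{-Σ(g|φ_x|⁴+ν|φ_x|²)} Σ_S (Π_{x∈S}(2g|φ_x|²+ν)) · ε det(rowUnitMatrix Aᵀ S)`. [folklore] -/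
theorem berezin_ofFun_mul_superGauss_mul_interactionForm_apply (h : FieldFun Λ) (A : Matrix Λ Λ ℂ)
    (g ν : ℝ) (φ : Λ → ℂ) :
    berezin (FieldFun Λ) (Λ ⊕ₗ Λ) (ofFun h * (superGauss A * interactionForm g ν)) φ =
      h φ * (Boson.gaussWeight A φ * cexp (-∑ x, interactionScalar g ν x φ)) *
        ∑ S : Finset Λ, (∏ x ∈ S, interactionCoeff g ν x φ) *
          (orientSign Λ * (rowUnitMatrix A.transpose S).det) := by
  rw [superGauss_mul_interactionForm, ← mul_assoc, ofFun_mul_ofFun,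
    berezin_ofFun_mul_grassmannExp_quadratic_add_diagonal]
  simp only [pairMoment_constMat, Pi.mul_apply, Finset.sum_apply, Finset.prod_apply, constFun]

/-- **Top coefficient of `h · e^{-S_{A + diag v}}`**:
`h(φ) e^{-φAφ̄} e^{-Σv_x|φ_x|²} Σ_S (Π_{x∈S} v_x) · ε det(rowUnitMatrix Aᵀ S)`. [folklore] -/
theorem berezin_ofFun_mul_superGauss_add_diagonal_apply (h : FieldFun Λ) (A : Matrix Λ Λ ℂ)
    (v : Λ → ℂ) (φ : Λ → ℂ) :
    berezin (FieldFun Λ) (Λ ⊕ₗ Λ) (ofFun h * superGauss (A + Matrix.diagonal v)) φ =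
      h φ * (Boson.gaussWeight A φ * cexp (-∑ x, v x * (((‖φ x‖ ^ 2 : ℝ)) : ℂ))) *
        ∑ S : Finset Λ, (∏ x ∈ S, v x) * (orientSign Λ * (rowUnitMatrix A.transpose S).det) := by
  rw [superGauss_add_diagonal, ← mul_assoc, ofFun_mul_ofFun,
    berezin_ofFun_mul_grassmannExp_quadratic_add_diagonal]
  simp only [pairMoment_constMat, Pi.mul_apply, Finset.sum_apply, Finset.prod_apply, constFun]

end TopCoefficients


/-! ### Per-site Gaussian–Fourier identities for `e^{-(ν+iw)s}` -/

section PerSite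

variable {g : ℝ}

/-- `|w|ρ_g(w)` is integrable. [folklore] -/
theorem integrable_abs_mul_gaussDensity (hg : 0 < g) : Integrable fun w : ℝ => |w| * gaussDensity g w := by
  have h := (integrable_mul_exp_neg_mul_sq (b := (4 * g)⁻¹) (by positivity)).norm.const_mul
    (Real.sqrt (4 * Real.pi * g))⁻¹
  refine h.congr (Eventually.of_forall fun w => ?_)
  simp only [gaussDensity, norm_mul, Real.norm_eq_abs, abs_of_pos (Real.exp_pos _)]
  have : -(4 * g)⁻¹ * w ^ 2 = -(w ^ 2 / (4 * g)) := by field_simp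
  rw [this]; ring

/-- **`∫ ρ_g(w) e^{-(ν+iw)s} dw = e^{-νs - gs²}`** (real `ν, s`). [cite: BrydgesImbrieSlade2009, Proposition 4.4 (proof: F(t) = (2π)^{-M}∫Ĥ(v)e^{Σ(-iv_x+ε)t_x}dv, here with Gaussian Ĥ)] -/
theorem integral_gaussDensity_mul_cexp_neg (hg : 0 < g) (ν s : ℝ) :
    ∫ w : ℝ, (gaussDensity g w : ℂ) * cexp (-((ν : ℂ) + I * w) * s) =
      (Real.exp (-(ν * s + g * s ^ 2)) : ℂ) := by
  have hsplit : ∀ w : ℝ, (gaussDensity g w : ℂ) * cexp (-((ν : ℂ) + I * w) * s) =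
      (Real.exp (-(ν * s)) : ℂ) * ((gaussDensity g w : ℂ) * cexp (-I * w * s)) := by
    intro w
    rw [Complex.ofReal_exp, ← mul_assoc, mul_comm (cexp _), mul_assoc, ← Complex.exp_add]
    congr 2; push_cast; ring
  simp_rw [hsplit]
  rw [integral_const_mul, integral_gaussDensity_mul_cexp hg s, ← Complex.ofReal_mul, ← Real.exp_add]
  congr 2; ring

/-- **`∫ ρ_g(w) (ν+iw) e^{-(ν+iw)s} dw = (ν + 2gs) e^{-νs - gs²}`**: the `s`-derivative of the previous
identity (differentiation under the integral sign). [folklore] -/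
theorem integral_gaussDensity_mul_lin_mul_cexp_neg (hg : 0 < g) (ν s : ℝ) :
    ∫ w : ℝ, (gaussDensity g w : ℂ) * (((ν : ℂ) + I * w) * cexp (-((ν : ℂ) + I * w) * s)) =
      (((ν + 2 * g * s) * Real.exp (-(ν * s + g * s ^ 2)) : ℝ) : ℂ) := by
  -- both sides are minus the derivative at `s` of `s ↦ ∫ ρ(w) e^{-(ν+iw)s} dw = e^{-νs-gs²}`
  set F : ℝ → ℝ → ℂ := fun s w => (gaussDensity g w : ℂ) * cexp (-((ν : ℂ) + I * w) * s) with hF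
  set F' : ℝ → ℝ → ℂ := fun s w =>
    (gaussDensity g w : ℂ) * (-((ν : ℂ) + I * w) * cexp (-((ν : ℂ) + I * w) * s)) with hF'
  have hFm : ∀ s, AEStronglyMeasurable (F s) volume := fun s => by
    have : Continuous (F s) := by
      simp only [hF]
      exact (Complex.continuous_ofReal.comp (continuous_gaussDensity g)).mul (by fun_prop)
    exact this.aestronglyMeasurable
  have hF'm : ∀ s, AEStronglyMeasurable (F' s) volume := fun s => by
    have : Continuous (F' s) := by
      simp only [hF']
      exact (Complex.continuous_ofReal.comp (continuous_gaussDensity g)).mul (by fun_prop)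
    exact this.aestronglyMeasurable
  -- integrability of `F s` from the explicit value (nonzero) is awkward; prove it directly
  have hFint : Integrable (F s) := by
    refine ((integrable_gaussDensity hg).const_mul (Real.exp (|ν| * |s|))).mono'
      (hFm s) (Eventually.of_forall fun w => ?_)
    simp only [hF, norm_mul, Complex.norm_real, Real.norm_eq_abs, abs_of_pos (gaussDensity_pos hg _)]
    rw [norm_cexp_neg_add_mul, mul_comm]
    refine mul_le_mul_of_nonneg_right (Real.exp_le_exp.2 ?_) (gaussDensity_pos hg _).le
    calc -(ν * s) ≤ |ν * s| := neg_le_abs _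
      _ = |ν| * |s| := abs_mul _ _
  -- domination of `F'` on `ball s 1`
  set bound : ℝ → ℝ := fun w => Real.exp (|ν| * (|s| + 1)) * ((|ν| + |w|) * gaussDensity g w) with hbound
  have hbound_int : Integrable bound := by
    refine Integrable.const_mul ?_ _
    have h1 := (integrable_gaussDensity hg).const_mul |ν|
    have h2 := integrable_abs_mul_gaussDensity hg
    refine (h1.add h2).congr (Eventually.of_forall fun w => ?_)
    simp only [Pi.add_apply]; ring
  have hdom : ∀ᵐ w ∂volume, ∀ s' ∈ Metric.ball s 1, ‖F' s' w‖ ≤ bound w := by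
    refine Eventually.of_forall fun w s' hs' => ?_
    have hs'1 : |s'| ≤ |s| + 1 := by
      have := Metric.mem_ball.1 hs'; rw [Real.dist_eq] at this
      calc |s'| = |s + (s' - s)| := by ring_nf
        _ ≤ |s| + |s' - s| := abs_add_le _ _
        _ ≤ |s| + 1 := by linarith [this.le]
    simp only [hF', hbound, norm_mul, norm_neg, Complex.norm_real, Real.norm_eq_abs,
      abs_of_pos (gaussDensity_pos hg _)]
    rw [norm_cexp_neg_add_mul]
    have hlin : ‖(ν : ℂ) + I * w‖ ≤ |ν| + |w| := by
      calc ‖(ν : ℂ) + I * w‖ ≤ ‖(ν : ℂ)‖ + ‖I * (w : ℂ)‖ := norm_add_le _ _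
        _ = |ν| + |w| := by rw [norm_mul, Complex.norm_I, one_mul, Complex.norm_real, Complex.norm_real,
            Real.norm_eq_abs, Real.norm_eq_abs]
    have hexp : Real.exp (-(ν * s')) ≤ Real.exp (|ν| * (|s| + 1)) := by
      refine Real.exp_le_exp.2 ?_
      calc -(ν * s') ≤ |ν * s'| := neg_le_abs _
        _ = |ν| * |s'| := abs_mul _ _
        _ ≤ |ν| * (|s| + 1) := mul_le_mul_of_nonneg_left hs'1 (abs_nonneg _)
    have hρ := (gaussDensity_pos hg w).le
    calc gaussDensity g w * (‖(ν : ℂ) + I * w‖ * Real.exp (-(ν * s')))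
        ≤ gaussDensity g w * ((|ν| + |w|) * Real.exp (|ν| * (|s| + 1))) := by
          refine mul_le_mul_of_nonneg_left ?_ hρ
          exact mul_le_mul hlin hexp (Real.exp_pos _).le (by positivity)
      _ = Real.exp (|ν| * (|s| + 1)) * ((|ν| + |w|) * gaussDensity g w) := by ring
  have hderiv : ∀ᵐ w ∂volume, ∀ s' ∈ Metric.ball s 1, HasDerivAt (fun s => F s w) (F' s' w) s' := by
    refine Eventually.of_forall fun w s' _ => ?_
    simp only [hF, hF']
    have h0 : HasDerivAt (fun s : ℝ => -((ν : ℂ) + I * w) * s) (-((ν : ℂ) + I * w)) s' := by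
      simpa using (hasDerivAt_id s').ofReal_comp.const_mul (-((ν : ℂ) + I * w))
    have h1 := h0.cexp.const_mul (gaussDensity g w : ℂ)
    refine h1.congr_deriv ?_
    ring
  have hkey := (hasDerivAt_integral_of_dominated_loc_of_deriv_le (μ := volume) (x₀ := s)
    (s := Metric.ball s 1) (F := F) (F' := F') (bound := bound) (Metric.ball_mem_nhds s one_pos)
    (Eventually.of_forall hFm) hFint (hF'm s) hdom hbound_int hderiv).2
  -- the same function through its explicit value
  have hexpl : (fun s => ∫ w, F s w) = fun s : ℝ => ((Real.exp (-(ν * s + g * s ^ 2)) : ℝ) : ℂ) := by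
    funext s; exact integral_gaussDensity_mul_cexp_neg hg ν s
  have hderiv2 : HasDerivAt (fun s : ℝ => ((Real.exp (-(ν * s + g * s ^ 2)) : ℝ) : ℂ))
      (((-(ν + 2 * g * s) * Real.exp (-(ν * s + g * s ^ 2)) : ℝ) : ℂ)) s := by
    have h1 : HasDerivAt (fun s : ℝ => -(ν * s + g * s ^ 2)) (-(ν + 2 * g * s)) s := by
      have h := ((hasDerivAt_id s).const_mul ν).add (((hasDerivAt_id s).pow 2).const_mul g)
      have h' : HasDerivAt (fun s : ℝ => ν * s + g * s ^ 2) (ν + 2 * g * s) s := by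
        refine h.congr_deriv ?_; simp; ring
      exact h'.neg
    refine (h1.exp).ofReal_comp.congr_deriv ?_
    push_cast; ring
  rw [hexpl] at hkey
  have huniq := hkey.unique hderiv2
  -- `∫ F' s = -(goal integral)`
  have hneg : ∫ w, F' s w = -∫ w : ℝ, (gaussDensity g w : ℂ) *
      (((ν : ℂ) + I * w) * cexp (-((ν : ℂ) + I * w) * s)) := by
    rw [← integral_neg]
    refine integral_congr_ae (Eventually.of_forall fun w => ?_)
    simp only [hF']; ring
  rw [hneg] at huniq
  have := congrArg Neg.neg huniq
  rw [neg_neg] at this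
  rw [this]
  push_cast; ring

end PerSite


/-! ### The site-by-site `w`-integral and the form-side `τ`-isomorphism -/

section FormSide

variable {Λ : Type*} [Fintype Λ] [LinearOrder Λ] {g ν : ℝ}

/-- **The `w`-integral factorises over the sites**: for `s : Λ → ℝ` and `S ⊆ Λ`,
`∫_{ℝ^Λ} Π_x ρ_g(w_x) e^{-(ν+iw_x)s_x} [ν+iw_x]^{𝟙(x∈S)} dw = Π_x e^{-νs_x-gs_x²} · Π_{x∈S}(ν + 2gs_x)`.
[cite: BrydgesImbrieSlade2009, Proposition 4.4 (proof, Fubini in the Fourier variables v)] -/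
theorem integral_prod_gaussDensity_site (hg : 0 < g) (ν : ℝ) (sv : Λ → ℝ) (S : Finset Λ) :
    ∫ w : Λ → ℝ, ∏ x, ((gaussDensity g (w x) : ℂ) * (cexp (-((ν : ℂ) + I * w x) * sv x) *
        (if x ∈ S then ((ν : ℂ) + I * w x) else 1))) =
      ∏ x, (if x ∈ S then ((((ν + 2 * g * sv x) * Real.exp (-(ν * sv x + g * sv x ^ 2)) : ℝ)) : ℂ)
        else ((Real.exp (-(ν * sv x + g * sv x ^ 2)) : ℝ) : ℂ)) := by
  rw [volume_pi, integral_fintype_prod_eq_prod (𝕜 := ℂ)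
    (f := fun x (t : ℝ) => (gaussDensity g t : ℂ) * (cexp (-((ν : ℂ) + I * t) * sv x) *
      (if x ∈ S then ((ν : ℂ) + I * t) else 1)))]
  refine Finset.prod_congr rfl fun x _ => ?_
  by_cases hx : x ∈ S
  · simp only [hx, if_true]
    rw [← integral_gaussDensity_mul_lin_mul_cexp_neg hg ν (sv x)]
    refine integral_congr_ae (Eventually.of_forall fun t => ?_); simp only; ring
  · simp only [hx, if_false, mul_one]
    exact integral_gaussDensity_mul_cexp_neg hg ν (sv x)

variable {A : Matrix Λ Λ ℂ}

/-- `A + ν + iW` has positive Hermitian part `≥ ν` when `Re φAφ̄ ≥ 0`. [cite: BrydgesImbrieSlade2009, Proposition 4.4 (proof: "A - εI + iV has positive Hermitian part")] -/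
theorem re_quadForm_add_diagonal_ge (hA : ∀ φ, 0 ≤ (Boson.quadForm A φ).re) (ν : ℝ) (w : Λ → ℝ)
    (φ : Λ → ℂ) :
    ν * ∑ x, ‖φ x‖ ^ 2 ≤ (Boson.quadForm (A + Matrix.diagonal fun x => (ν : ℂ) + I * w x) φ).re := by
  rw [quadForm_add, Complex.add_re, quadForm_diagonal, Complex.re_sum, Finset.mul_sum]
  have h : ∀ x, (((ν : ℂ) + I * w x) * (((‖φ x‖ ^ 2 : ℝ)) : ℂ)).re = ν * ‖φ x‖ ^ 2 := by
    intro x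
    rw [Complex.mul_re, Complex.ofReal_re, Complex.ofReal_im, mul_zero, sub_zero]
    simp [Complex.add_re]
  simp_rw [h]
  linarith [hA φ]

/-- The pointwise Gaussian–Fourier representation of the top coefficient of
`h e^{-S_A}e^{-Σ(gτ²+ντ)}` as the `ρ_g^{⊗Λ}`-average of the top coefficients of `h e^{-S_{A+ν+iW}}`.
[cite: BrydgesImbrieSlade2009, Proposition 4.4 (proof: "We may replace t by τ in (invFT)")] -/
theorem berezin_interaction_eq_integral (hg : 0 < g) (ν : ℝ) (h : FieldFun Λ) (A : Matrix Λ Λ ℂ)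
    (φ : Λ → ℂ) :
    berezin (FieldFun Λ) (Λ ⊕ₗ Λ) (ofFun h * (superGauss A * interactionForm g ν)) φ =
      ∫ w : Λ → ℝ, (∏ x, (gaussDensity g (w x) : ℂ)) *
        berezin (FieldFun Λ) (Λ ⊕ₗ Λ)
          (ofFun h * superGauss (A + Matrix.diagonal fun x => (ν : ℂ) + I * w x)) φ := by
  classical
  set sv : Λ → ℝ := fun x => ‖φ x‖ ^ 2 with hsv
  set μS : Finset Λ → ℂ := fun S => orientSign Λ * (rowUnitMatrix A.transpose S).det with hμS
  rw [berezin_ofFun_mul_superGauss_mul_interactionForm_apply]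
  have hw : ∀ w : Λ → ℝ, berezin (FieldFun Λ) (Λ ⊕ₗ Λ)
      (ofFun h * superGauss (A + Matrix.diagonal fun x => (ν : ℂ) + I * w x)) φ =
      h φ * (Boson.gaussWeight A φ * cexp (-∑ x, ((ν : ℂ) + I * w x) * (((‖φ x‖ ^ 2 : ℝ)) : ℂ))) *
        ∑ S : Finset Λ, (∏ x ∈ S, ((ν : ℂ) + I * w x)) * μS S :=
    fun w => by rw [hμS]; exact berezin_ofFun_mul_superGauss_add_diagonal_apply h A _ φ
  simp_rw [hw]
  -- also fold `μS` on the left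
  have hleft : (∑ S : Finset Λ, (∏ x ∈ S, interactionCoeff g ν x φ) *
      (orientSign Λ * (rowUnitMatrix A.transpose S).det)) =
      ∑ S : Finset Λ, (∏ x ∈ S, interactionCoeff g ν x φ) * μS S := by rw [hμS]
  rw [hleft]
  -- rewrite the `w`-integrand as `K · Σ_S μ_S Π_x(ρ e^{-(ν+iw)s} c_x)`
  have hrw : ∀ w : Λ → ℝ, (∏ x, (gaussDensity g (w x) : ℂ)) *
      (h φ * (Boson.gaussWeight A φ * cexp (-∑ x, ((ν : ℂ) + I * w x) * (((‖φ x‖ ^ 2 : ℝ)) : ℂ))) *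
        ∑ S : Finset Λ, (∏ x ∈ S, ((ν : ℂ) + I * w x)) * μS S) =
      ∑ S : Finset Λ, (h φ * Boson.gaussWeight A φ * μS S) *
        ∏ x, ((gaussDensity g (w x) : ℂ) * (cexp (-((ν : ℂ) + I * w x) * sv x) *
          (if x ∈ S then ((ν : ℂ) + I * w x) else 1))) := by
    intro w
    rw [Finset.mul_sum, Finset.mul_sum]
    refine Finset.sum_congr rfl fun S _ => ?_
    have hexp : cexp (-∑ x, ((ν : ℂ) + I * w x) * (((‖φ x‖ ^ 2 : ℝ)) : ℂ)) =
        ∏ x, cexp (-((ν : ℂ) + I * w x) * sv x) := by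
      rw [← Complex.exp_sum, ← Finset.sum_neg_distrib]
      refine congrArg cexp (Finset.sum_congr rfl fun x _ => ?_)
      rw [hsv]; ring
    have hite : (∏ x ∈ S, ((ν : ℂ) + I * w x)) = ∏ x, (if x ∈ S then ((ν : ℂ) + I * w x) else 1) := by
      rw [Finset.prod_ite_mem, Finset.univ_inter]
    rw [hexp, hite, Finset.prod_mul_distrib, Finset.prod_mul_distrib]
    ring
  simp_rw [hrw]
  -- integrate the finite sum term by term
  have hint : ∀ S : Finset Λ, Integrable fun w : Λ → ℝ => (h φ * Boson.gaussWeight A φ * μS S) *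
      ∏ x, ((gaussDensity g (w x) : ℂ) * (cexp (-((ν : ℂ) + I * w x) * sv x) *
        (if x ∈ S then ((ν : ℂ) + I * w x) else 1))) := by
    intro S
    refine Integrable.const_mul ?_ _
    have := Integrable.fintype_prod (𝕜 := ℂ) (μ := fun _ : Λ => (volume : Measure ℝ))
      (f := fun x (t : ℝ) => (gaussDensity g t : ℂ) * (cexp (-((ν : ℂ) + I * t) * sv x) *
        (if x ∈ S then ((ν : ℂ) + I * t) else 1))) fun x => ?_
    · rw [← volume_pi] at this; exact this
    · -- `|ρ(t) e^{-(ν+it)s}(ν+it)| ≤ e^{|ν||s|} (|ν|+|t|) ρ(t)`, integrable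
      have hb : Integrable fun t : ℝ => Real.exp (|ν| * |sv x|) * ((|ν| + |t| + 1) * gaussDensity g t) := by
        refine Integrable.const_mul ?_ _
        have h1 := (integrable_gaussDensity hg).const_mul (|ν| + 1)
        have h2 := integrable_abs_mul_gaussDensity hg
        refine (h1.add h2).congr (Eventually.of_forall fun t => ?_)
        simp only [Pi.add_apply]; ring
      refine hb.mono' ?_ (Eventually.of_forall fun t => ?_)
      · have hc : Continuous fun t : ℝ => cexp (-((ν : ℂ) + I * t) * sv x) *
            (if x ∈ S then ((ν : ℂ) + I * t) else 1) := by
          by_cases hxS : x ∈ S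
          · simp only [hxS, if_true]; fun_prop
          · simp only [hxS, if_false, mul_one]; fun_prop
        exact ((Complex.continuous_ofReal.comp (continuous_gaussDensity g)).mul hc).aestronglyMeasurable
      · simp only [norm_mul, Complex.norm_real, Real.norm_eq_abs, abs_of_pos (gaussDensity_pos hg _)]
        rw [norm_cexp_neg_add_mul]
        have hlin : ‖(if x ∈ S then ((ν : ℂ) + I * t) else 1)‖ ≤ |ν| + |t| + 1 := by
          split_ifs
          · calc ‖(ν : ℂ) + I * t‖ ≤ ‖(ν : ℂ)‖ + ‖I * (t : ℂ)‖ := norm_add_le _ _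
              _ = |ν| + |t| := by rw [norm_mul, Complex.norm_I, one_mul, Complex.norm_real,
                  Complex.norm_real, Real.norm_eq_abs, Real.norm_eq_abs]
              _ ≤ |ν| + |t| + 1 := by linarith
          · simp; positivity
        have hexp : Real.exp (-(ν * sv x)) ≤ Real.exp (|ν| * |sv x|) := by
          refine Real.exp_le_exp.2 ?_
          calc -(ν * sv x) ≤ |ν * sv x| := neg_le_abs _
            _ = |ν| * |sv x| := abs_mul _ _
        have hρ := (gaussDensity_pos hg t).le
        calc gaussDensity g t * (Real.exp (-(ν * sv x)) * ‖(if x ∈ S then ((ν : ℂ) + I * t) else 1)‖)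
            ≤ gaussDensity g t * (Real.exp (|ν| * |sv x|) * (|ν| + |t| + 1)) := by
              refine mul_le_mul_of_nonneg_left ?_ hρ
              exact mul_le_mul hexp hlin (norm_nonneg _) (Real.exp_pos _).le
          _ = Real.exp (|ν| * |sv x|) * ((|ν| + |t| + 1) * gaussDensity g t) := by ring
  rw [integral_finsetSum _ fun S _ => hint S]
  simp_rw [integral_const_mul, integral_prod_gaussDensity_site hg ν sv]
  -- identify with the interaction top coefficient
  rw [Finset.mul_sum]
  refine Finset.sum_congr rfl fun S _ => ?_
  have hprod : (∏ x, (if x ∈ S then ((((ν + 2 * g * sv x) * Real.exp (-(ν * sv x + g * sv x ^ 2)) : ℝ)) : ℂ)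
      else ((Real.exp (-(ν * sv x + g * sv x ^ 2)) : ℝ) : ℂ))) =
      cexp (-∑ x, interactionScalar g ν x φ) * ∏ x ∈ S, interactionCoeff g ν x φ := by
    have h1 : ∀ x, (if x ∈ S then ((((ν + 2 * g * sv x) * Real.exp (-(ν * sv x + g * sv x ^ 2)) : ℝ)) : ℂ)
        else ((Real.exp (-(ν * sv x + g * sv x ^ 2)) : ℝ) : ℂ)) =
        cexp (-interactionScalar g ν x φ) * (if x ∈ S then interactionCoeff g ν x φ else 1) := by
      intro x
      have hsc : cexp (-interactionScalar g ν x φ) = ((Real.exp (-(ν * sv x + g * sv x ^ 2)) : ℝ) : ℂ) := by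
        rw [Complex.ofReal_exp]; congr 1; simp only [interactionScalar, hsv]; push_cast; ring
      have hco : interactionCoeff g ν x φ = (((ν + 2 * g * sv x) : ℝ) : ℂ) := by
        simp only [interactionCoeff, hsv]; push_cast; ring
      rw [hsc, hco]
      split_ifs <;> push_cast <;> ring
    simp_rw [h1]
    rw [Finset.prod_mul_distrib, ← Complex.exp_sum, Finset.sum_neg_distrib, Finset.prod_ite_mem,
      Finset.univ_inter]
  rw [hprod]
  ring

/-- `Π_{x∈S} f_x ≤ Π_x (1 + f_x)` for `f ≥ 0`. [folklore] -/
theorem prod_le_prod_one_add {f : Λ → ℝ} (hf : ∀ x, 0 ≤ f x) (S : Finset Λ) :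
    ∏ x ∈ S, f x ≤ ∏ x, (1 + f x) := by
  classical
  have h1 : ∏ x ∈ S, f x ≤ ∏ x ∈ S, (1 + f x) :=
    Finset.prod_le_prod (fun x _ => hf x) fun x _ => by linarith [hf x]
  have h2 : (∏ x ∈ S, (1 + f x)) * ∏ x ∈ Sᶜ, (1 + f x) = ∏ x, (1 + f x) :=
    Finset.prod_mul_prod_compl S _
  have h3 : 1 ≤ ∏ x ∈ Sᶜ, (1 + f x) :=
    Finset.prod_induction _ (fun r => 1 ≤ r) (fun a b ha hb => one_le_mul_of_one_le_of_one_le ha hb)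
      le_rfl fun x _ => by linarith [hf x]
  have h4 : 0 ≤ ∏ x ∈ S, (1 + f x) := Finset.prod_nonneg fun x _ => by linarith [hf x]
  calc ∏ x ∈ S, f x ≤ ∏ x ∈ S, (1 + f x) := h1
    _ = (∏ x ∈ S, (1 + f x)) * 1 := (mul_one _).symm
    _ ≤ (∏ x ∈ S, (1 + f x)) * ∏ x ∈ Sᶜ, (1 + f x) := mul_le_mul_of_nonneg_left h3 h4
    _ = ∏ x, (1 + f x) := h2

/-- The diagonal matrix `ν·1` has positive Hermitian part `ν`. [folklore] -/
theorem re_quadForm_diagonal_const (ν : ℝ) (φ : Λ → ℂ) :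
    ν * ∑ x, ‖φ x‖ ^ 2 ≤ (Boson.quadForm (Matrix.diagonal fun _ : Λ => (ν : ℂ)) φ).re := by
  rw [quadForm_diagonal, Complex.re_sum, Finset.mul_sum]
  refine le_of_eq (Finset.sum_congr rfl fun x _ => ?_)
  rw [Complex.mul_re, Complex.ofReal_re, Complex.ofReal_im, Complex.ofReal_re, Complex.ofReal_im, mul_zero,
    sub_zero]

/-- `‖e^{-φ(ν1)φ̄}‖ = e^{-νΣ|φ_x|²}`. [folklore] -/
theorem norm_gaussWeight_diagonal_const (ν : ℝ) (φ : Λ → ℂ) :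
    ‖Boson.gaussWeight (Matrix.diagonal fun _ : Λ => (ν : ℂ)) φ‖ = Real.exp (-(ν * ∑ x, ‖φ x‖ ^ 2)) := by
  rw [Boson.norm_gaussWeight, quadForm_diagonal, Complex.re_sum, Finset.mul_sum]
  congr 2
  refine Finset.sum_congr rfl fun x _ => ?_
  rw [Complex.mul_re, Complex.ofReal_re, Complex.ofReal_im, Complex.ofReal_re, Complex.ofReal_im, mul_zero,
    sub_zero]

/-- **The form side of the `τ`-isomorphism for the weakly self-avoiding walk weight** ([BIS09],
Proposition 4.4 / Theorem 5.1, with the Fourier decomposition made Gaussian and explicit): for a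
complex matrix `A` with `Re φAφ̄ ≥ 0` (e.g. `A = -Δ_Λ`), `g > 0`, `ν > 0` and sites `a, b`,
`∫ e^{-S_A} e^{-Σ_x(gτ_x²+ντ_x)} φ̄_a φ_b = ∫_{ℝ^Λ} Π_xρ_g(w_x) · ((A + ν + iW)⁻¹)_{a,b} dw`,
where `W = diag(w)`: the top coefficient is the `ρ_g^{⊗Λ}`-average of those of `φ̄_aφ_b e^{-S_{A+ν+iW}}`
(`berezin_interaction_eq_integral`), Fubini, and `∫e^{-S_B}φ̄_aφ_b = (B⁻¹)_{a,b}` for `B = A + ν + iW`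
(`superIntegral_ofFun_mul_superGauss`, positive Hermitian part `ν`).
[cite: BrydgesImbrieSlade2009, Proposition 4.4, eq. (FDynkin) (proof) and Theorem 5.1]
[cite: BauerschmidtBrydgesSlade2015LogCorr, Proposition 3.1] -/
theorem superIntegral_interaction_eq_integral_resolvent (hA : ∀ φ, 0 ≤ (Boson.quadForm A φ).re)
    (hg : 0 < g) (hν : 0 < ν) (a b : Λ) :
    superIntegral (ofFun (fun φ => φ b * conj (φ a)) * (superGauss A * interactionForm g ν)) =
      ∫ w : Λ → ℝ, (∏ x, (gaussDensity g (w x) : ℂ)) *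
        (A + Matrix.diagonal fun x => (ν : ℂ) + I * w x)⁻¹ a b := by
  classical
  set h : FieldFun Λ := fun φ => φ b * conj (φ a) with hh
  set μS : Finset Λ → ℂ := fun S => orientSign Λ * (rowUnitMatrix A.transpose S).det with hμS
  -- the (φ, w) integrand and its explicit form
  set T : (Λ → ℂ) → (Λ → ℝ) → ℂ := fun φ w => (∏ x, (gaussDensity g (w x) : ℂ)) *
    berezin (FieldFun Λ) (Λ ⊕ₗ Λ) (ofFun h * superGauss (A + Matrix.diagonal fun x => (ν : ℂ) + I * w x)) φ
    with hT
  have hTexpl : ∀ φ w, T φ w = (∏ x, (gaussDensity g (w x) : ℂ)) *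
      (h φ * (Boson.gaussWeight A φ * cexp (-∑ x, ((ν : ℂ) + I * w x) * (((‖φ x‖ ^ 2 : ℝ)) : ℂ))) *
        ∑ S : Finset Λ, (∏ x ∈ S, ((ν : ℂ) + I * w x)) * μS S) := by
    intro φ w; rw [hT, hμS]; simp only; rw [berezin_ofFun_mul_superGauss_add_diagonal_apply]
  -- Step 1: LHS as an iterated integral
  have h1 : superIntegral (ofFun h * (superGauss A * interactionForm g ν)) =
      orientSign Λ * ((Real.pi : ℂ)⁻¹) ^ Fintype.card Λ * ∫ φ : Λ → ℂ, ∫ w : Λ → ℝ, T φ w := by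
    rw [superIntegral]
    congr 1
    exact integral_congr_ae (Eventually.of_forall fun φ => berezin_interaction_eq_integral hg ν h A φ)
  -- Step 2: joint integrability
  set Cμ : ℝ := ∑ S : Finset Λ, ‖μS S‖ with hCμ
  set gφ : (Λ → ℂ) → ℝ := fun φ => Cμ * (‖φ a‖ * ‖φ b‖ * Real.exp (-(ν * ∑ x, ‖φ x‖ ^ 2))) with hgφ
  set fw : (Λ → ℝ) → ℝ := fun w => ∏ x, gaussDensity g (w x) * (1 + (|ν| + |w x|)) with hfw
  have hgφ_int : Integrable gφ := by
    have hB := re_quadForm_diagonal_const (Λ := Λ) ν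
    have h0 := (Boson.integrable_conjCoord_mul_coord_mul_gaussWeight hν hB a b).norm.const_mul Cμ
    refine h0.congr (Eventually.of_forall fun φ => ?_)
    simp only [hgφ, norm_mul, Complex.norm_conj, norm_gaussWeight_diagonal_const]
  have hfw_int : Integrable fw := by
    have := Integrable.fintype_prod (𝕜 := ℝ) (μ := fun _ : Λ => (volume : Measure ℝ))
      (f := fun (_ : Λ) (t : ℝ) => gaussDensity g t * (1 + (|ν| + |t|))) fun _ => ?_
    · rw [← volume_pi] at this; exact this
    · have h1 := (integrable_gaussDensity hg).const_mul (1 + |ν|)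
      have h2 := integrable_abs_mul_gaussDensity hg
      refine (h1.add h2).congr (Eventually.of_forall fun t => ?_)
      simp only [Pi.add_apply]; ring
  have hTint : Integrable (Function.uncurry T) ((volume : Measure (Λ → ℂ)).prod volume) := by
    have hB := hgφ_int.mul_prod hfw_int
    refine hB.mono' ?_ (Eventually.of_forall fun p => ?_)
    · have hcont : Continuous (Function.uncurry T) := by
        have : Function.uncurry T = fun p : (Λ → ℂ) × (Λ → ℝ) => (∏ x, (gaussDensity g (p.2 x) : ℂ)) *
            (h p.1 * (Boson.gaussWeight A p.1 * cexp (-∑ x, ((ν : ℂ) + I * p.2 x) *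
              (((‖p.1 x‖ ^ 2 : ℝ)) : ℂ))) * ∑ S : Finset Λ, (∏ x ∈ S, ((ν : ℂ) + I * p.2 x)) * μS S) := by
          funext p; exact hTexpl p.1 p.2
        rw [this]
        refine Continuous.mul ?_ (Continuous.mul (Continuous.mul ?_ (Continuous.mul ?_ ?_)) ?_)
        · exact continuous_finsetProd _ fun x _ => Complex.continuous_ofReal.comp
            ((continuous_gaussDensity g).comp ((continuous_apply x).comp continuous_snd))
        · simp only [hh]; fun_prop
        · unfold Boson.gaussWeight Boson.quadForm; fun_prop
        · refine Complex.continuous_exp.comp (Continuous.neg (continuous_finsetSum _ fun x _ => ?_))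
          fun_prop
        · refine continuous_finsetSum _ fun S _ => Continuous.mul ?_ continuous_const
          exact continuous_finsetProd _ fun x _ => by fun_prop
      exact hcont.aestronglyMeasurable
    · rcases p with ⟨φ, w⟩
      simp only [Function.uncurry_apply_pair]
      rw [hTexpl]
      -- norms of the factors
      have hρ : ‖∏ x, (gaussDensity g (w x) : ℂ)‖ = ∏ x, gaussDensity g (w x) := by
        rw [norm_prod]; exact Finset.prod_congr rfl fun x _ => by
          rw [Complex.norm_real, Real.norm_eq_abs, abs_of_pos (gaussDensity_pos hg _)]
      have hgw : ‖Boson.gaussWeight A φ‖ ≤ 1 := by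
        rw [Boson.norm_gaussWeight]; exact Real.exp_le_one_iff.2 (by linarith [hA φ])
      have hexp : ‖cexp (-∑ x, ((ν : ℂ) + I * w x) * (((‖φ x‖ ^ 2 : ℝ)) : ℂ))‖ =
          Real.exp (-(ν * ∑ x, ‖φ x‖ ^ 2)) := by
        rw [Complex.norm_exp]; congr 1
        rw [Complex.neg_re, Complex.re_sum, Finset.mul_sum]; congr 1
        refine Finset.sum_congr rfl fun x _ => ?_
        rw [Complex.mul_re, Complex.ofReal_re, Complex.ofReal_im, mul_zero, sub_zero]
        simp [Complex.add_re]
      have hlin : ∀ x, ‖(ν : ℂ) + I * w x‖ ≤ |ν| + |w x| := fun x =>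
        calc ‖(ν : ℂ) + I * w x‖ ≤ ‖(ν : ℂ)‖ + ‖I * (w x : ℂ)‖ := norm_add_le _ _
          _ = |ν| + |w x| := by rw [norm_mul, Complex.norm_I, one_mul, Complex.norm_real,
              Complex.norm_real, Real.norm_eq_abs, Real.norm_eq_abs]
      have hterm : ∀ S : Finset Λ, ‖∏ x ∈ S, ((ν : ℂ) + I * w x)‖ ≤ ∏ x, (1 + (|ν| + |w x|)) :=
        fun S =>
        calc ‖∏ x ∈ S, ((ν : ℂ) + I * w x)‖ = ∏ x ∈ S, ‖(ν : ℂ) + I * w x‖ := norm_prod _ _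
          _ ≤ ∏ x ∈ S, (|ν| + |w x|) := Finset.prod_le_prod (fun x _ => norm_nonneg _) fun x _ => hlin x
          _ ≤ ∏ x, (1 + (|ν| + |w x|)) :=
              prod_le_prod_one_add (f := fun x => |ν| + |w x|) (fun x => by positivity) S
      have hsum : ‖∑ S : Finset Λ, (∏ x ∈ S, ((ν : ℂ) + I * w x)) * μS S‖ ≤
          Cμ * ∏ x, (1 + (|ν| + |w x|)) := by
        refine (norm_sum_le _ _).trans ?_
        rw [hCμ, Finset.sum_mul]
        refine Finset.sum_le_sum fun S _ => ?_
        rw [norm_mul, mul_comm]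
        exact mul_le_mul_of_nonneg_left (hterm S) (norm_nonneg _)
      have hhn : ‖h φ‖ = ‖φ a‖ * ‖φ b‖ := by
        simp only [hh, norm_mul, Complex.norm_conj]; ring
      -- assemble
      simp only [norm_mul, hρ, hhn, hexp]
      have hnn1 : 0 ≤ ∏ x, gaussDensity g (w x) := Finset.prod_nonneg fun x _ => (gaussDensity_pos hg _).le
      calc (∏ x, gaussDensity g (w x)) * (‖φ a‖ * ‖φ b‖ * (‖Boson.gaussWeight A φ‖ *
            Real.exp (-(ν * ∑ x, ‖φ x‖ ^ 2))) * ‖∑ S : Finset Λ, (∏ x ∈ S, ((ν : ℂ) + I * w x)) * μS S‖)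
          ≤ (∏ x, gaussDensity g (w x)) * (‖φ a‖ * ‖φ b‖ * (1 * Real.exp (-(ν * ∑ x, ‖φ x‖ ^ 2))) *
            (Cμ * ∏ x, (1 + (|ν| + |w x|)))) := by
            gcongr
      _ = gφ φ * fw w := by
            simp only [hgφ, hfw, Finset.prod_mul_distrib]; ring
  -- Step 3: swap and evaluate the `φ`-integral for each `w`
  rw [h1, integral_integral_swap hTint]
  have h3 : ∀ w : Λ → ℝ, ∫ φ : Λ → ℂ, T φ w = (∏ x, (gaussDensity g (w x) : ℂ)) *
      ∫ φ : Λ → ℂ, berezin (FieldFun Λ) (Λ ⊕ₗ Λ)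
        (ofFun h * superGauss (A + Matrix.diagonal fun x => (ν : ℂ) + I * w x)) φ := fun w => by
    rw [hT]; exact integral_const_mul _ _
  simp_rw [h3]
  rw [← integral_const_mul]
  refine integral_congr_ae (Eventually.of_forall fun w => ?_)
  have hsI := superIntegral_ofFun_mul_superGauss hν (re_quadForm_add_diagonal_ge hA ν w) b a
  rw [superIntegral] at hsI
  simp only [hh] at hsI ⊢
  rw [← hsI]
  ring

end FormSide

end CTWSAW

end Literature.Barriers.CriticalPhenomena
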